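import Literature.MathematicalPhysics.QuantumFieldTheory.Balaban1983to89.T4ForestGaugeCorridorBound
import Literature.MathematicalPhysics.QuantumFieldTheory.Balaban1983to89.LatticeWordCountBox
import Literature.MathematicalPhysics.QuantumFieldTheory.Balaban1983to89.B15Prop1MinimiserTowerAxialGauge

/-!
# `Balaban1983to89.B15Prop1InteriorLetterCorridor` — [Balaban1985Variational] = «[15]», (16)–(18) p. 280 ∕ [Balaban1985RegularSpaces] = «[6]», (1.19) p. 79:
# THE CORRIDOR (TWO-ROOT) HALF OF THE INTERIOR LETTER `hL` REDUCED TO A ROOT-TRANSPORTER LETTER — in the tower-axial gauge `σ(x) = 𝒰_{U₀}(path x)` every bond inside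
# `Ω₁(Z)` whose endpoints hang from two DIFFERENT roots is within `((2ℓ + 1 + ℓT)²∕4)·εP + eT + dG` of `1` as soon as the two roots are joined by a fine word of length
# `≤ ℓT` whose `U₀`-transport is `eT`-near a `dG`-near-`1` group element, and the plaquettes in the box of radius `2ℓ + 1 + ℓT` around the first root are `εP`-small

statement-level skeleton of published theorems with citation tags; proofs where landed; nothing here is a claim about the Yang–Mills mass gap

WHY (cell `pub-ymgap`, HUMAN RULINGS D-0062 ∕ D-0149 ∕ D-0154, width seat `pub-ymgap-dag-n12-w6` g2; node N12 = [B15]; lane word dag-n12-c g19 «hL-corridor: w6's next», cell bus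
2026-08-28).  `B15Prop1InteriorLetterSameRoot` split the interior letter of the localised gauge letter (σ)_N into `hL_same` (discharged there from one plaquette letter) and the displayed
`hL_corridor : ∀ b, b.src ∈ Ω₁ → b.tgt ∈ Ω₁ → root b.src ≠ root b.tgt → ‖↑((U₀^σ) b) − 1‖ ≤ Θc`.  The MASTER bound of `T4ForestGaugeCorridorBound` (p628442) treats such a bond
`⟨s, s + e_μ⟩` given ANY fine word `Ω` from `root s` to `root (s + e_μ)` whose transporter is within `e` of a group element `g`: `(U₀^σ)(b) = Λ · (𝒰(Ω) g⁻¹) · g` with `Λ` the holonomy of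
the closed word `w₁ · (+e_μ) · (Ω · w₂)ᵒᵖ` at the first root (located Stokes).  So the corridor half needs exactly ONE more datum than the same-root half: a ROOT-TRANSPORTER LETTER
«neighbouring roots are joined by short words with near-trivial transport» — the content of [15] (16)–(18) between the points of `𝔅_k` ([6] (1.19): in `Ax_k(𝔅_k, U₀)` the variables
`u(y)u(y′)⁻¹`, `y, y′ ∈ 𝔅_k`, are controlled by the constrained averages and the small plaquettes between the towers).  THIS FILE performs that reduction (first layer); the
transporter letter itself is inhabited per root pair from CHAINS of member-bond segments (dag-n12-w2's `BlockAveragingTowerStraightTransportLocal`, p628442 §1∕§3 chaining) and the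
chain geometry of `𝐁_k(Z)` (dag-n12-w3's root-point classification) — the second layer, next file of this lineage; §3's `rootTransporter_of_chain` is its socket.

CONTENTS (theorems only; no `def`, no `instance`, no `sorry`).
* §1 ★★ `dist1_gaugeAct_holAtGauge_le_of_transporter_of_boxPlaqs` — ONE two-root bond, box edition of the MASTER bound: words `|w₁|, |w₂| ≤ ℓ`, transporter word `|Ω| ≤ ℓT` with
  `dist1 (𝒰(walk r₁ Ω)·g⁻¹) ≤ e`, `2ℓ + 1 + ℓT <` sites per direction, `PlaqSmallOn S δ U` with `boxPlaqs (z − R) (z + R + 2) ⊆ S` at `r₁ = castSite z`, `R = 2ℓ + 1 + ℓT` ⟹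
  `dist1 ((U^σ)⟨s, μ⟩) ≤ (R²∕4)·δ + e + dist1 g`.
* §2 ★★ `dist1_gaugeAct_holAtGauge_le_of_rootNe` — the forest-in-word-currency edition on a site set `Ω` with the ROOT-TRANSPORTER LETTER `hT`.
* §3 ★★★ `interiorLetter_corridor_atRecord` — the `SU(2)` reading at `Ω₁(Z) = maxDomT ν.M₁ Z 1` = the `hL_corridor` text of `B15Prop1InteriorLetterSameRoot` verbatim, with
  `Θc := (R²∕4)·εP + eT + dG`; ★ `interiorLetter_corridor_linear` (all three data linear in the guard ⟹ `Θc ≤ (R²∕4·CP + CT + CG)·eR`); ★ `rootTransporter_of_chain` — the second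
  layer's socket: a chain of links `(ω_l, g_l, e_l)` read consecutively from a root gives the transporter datum `(Ω, g, e, dG) = (ω_1⋯ω_m, Π g_l, Σ e_l, Σ dist1 g_l)` with `|Ω| = Σ |ω_l|`.

HONEST FRAMING: [folklore] lattice∕group bookkeeping + landed bricks by name; the root-transporter letter, the forest, the minimiser ([15] Thm 1) and the plaquette letter stay DISPLAYED;
nothing of Bałaban's is asserted; count-neutral; N12 NOT discharged; finite 𝕋⁴ at fixed ε; nothing continuum ∕ OS ∕ mass-gap ∕ Clay.
-/

noncomputable section

open scoped Matrix.Norms.L2Operator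

namespace Literature.MathematicalPhysics.QuantumFieldTheory.Balaban1983to89.B15Prop1InteriorLetterCorridor

open T4Continuum GaugeField B15DeterminingSets
open T4CubeChartGnomonic (SU2)
open T4AxialGaugeSmallField (castSite boxPlaqs)
open B14.Eq213DetSet (maxDomT)
open T4ForestGaugeCorridorBound (dist1_gaugeAct_holAtGauge_le_of_transporter dist1_holAt_chain_mul_prod_inv_le dist1_prod_le_sum length_flatten_map_fst)
open LatticeWordCountBox (plaq_countBox_lt_of_plaqSmallOn_boxPlaqs_length)

variable {P : Params}

/-! ## §1  One bond between two towers: the box edition of the MASTER bound -/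

section OneBond

variable {G : Type*} [GaugeGroup G]

/-- The closed word `w₁ · (+e_μ) · (Ω · w₂)ᵒᵖ` of the MASTER bound has length `|w₁| + 1 + (|Ω| + |w₂|)`. [folklore] -/
private theorem length_masterWord (μ : Fin P.d) (w₁ Ω w₂ : List (Letter P.d)) :
    (w₁ ++ (μ, true) :: wordRev (Ω ++ w₂)).length = w₁.length + 1 + (Ω.length + w₂.length) := by
  simp only [List.length_append, List.length_cons, wordRev, List.length_reverse, List.length_map]
  omega

/-- A coordinate box grows with its radius. [folklore] -/
private theorem boxPlaqs_radius_mono {j : ℕ} (z : Fin P.d → ℤ) {a b : ℤ} (hab : a ≤ b) :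
    (boxPlaqs (fun ν => z ν - a) (fun ν => z ν + a + 2) : Set (Plaq P j)) ⊆ boxPlaqs (fun ν => z ν - b) (fun ν => z ν + b + 2) := by
  rintro p ⟨z', hlo, hhi, hsrc⟩
  refine ⟨z', fun ν => le_trans ?_ (hlo ν), fun ν => (hhi ν).trans ?_, hsrc⟩
  · show z ν - b ≤ z ν - a
    linarith
  · show z ν + a + 2 ≤ z ν + b + 2
    linarith

/-- ★★ **THE TWO-ROOT BOND BOUND, BOX EDITION** (the MASTER bound `T4ForestGaugeCorridorBound.dist1_gaugeAct_holAtGauge_le_of_transporter` with its count-box premise discharged from ONE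
coordinate box).  In the forest gauge `σ(x) = 𝒰_U(path x)`: `path s = walk r₁ w₁`, `path (s + e_μ) = walk r₂ w₂` ending at `s`, `s + e_μ`, `|w₁|, |w₂| ≤ ℓ`; a fine word `Ω` from `r₁` to `r₂`
of length `≤ ℓT` whose transporter is within `e` of `g`; `2ℓ + 1 + ℓT <` sites per direction; `r₁ = castSite z` and every plaquette with corners in `[z − R, z + R + 2]`, `R = 2ℓ + 1 + ℓT`, is
`δ`-small (`0 ≤ δ`).  THEN `dist1 ((U^σ)⟨s, μ⟩) ≤ (R²∕4)·δ + e + dist1 g`. [cite: Balaban1985Variational, (16)–(18) p.280; Balaban1985RegularSpaces, (1.19) p.79; Balaban1985Averaging, (19)–(20) p.21] -/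
theorem dist1_gaugeAct_holAtGauge_le_of_transporter_of_boxPlaqs (U : GaugeField P 0 G) (path : Site P 0 → List (LStep P 0))
    (r₁ r₂ : Site P 0) (Ω : List (Letter P.d)) (hΩ : walkEnd r₁ Ω = r₂) (g : G) {e : ℝ} (hH : dist1 (holAt U (walk r₁ Ω) * g⁻¹) ≤ e)
    (s : Site P 0) (μ : Fin P.d) (w₁ w₂ : List (Letter P.d))
    (hps : path s = walk r₁ w₁) (hpt : path (s.shift μ) = walk r₂ w₂) (hs : walkEnd r₁ w₁ = s) (ht : walkEnd r₂ w₂ = s.shift μ)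
    {ℓ ℓT : ℕ} (hw₁ : w₁.length ≤ ℓ) (hw₂ : w₂.length ≤ ℓ) (hΩl : Ω.length ≤ ℓT) (hN : 2 * ℓ + 1 + ℓT < P.sitesPerDir 0)
    (z : Fin P.d → ℤ) (hz : (castSite z : Site P 0) = r₁) {S : Set (Plaq P 0)} {δ : ℝ} (hδ : 0 ≤ δ) (hU : PlaqSmallOn S δ U)
    (hS : (boxPlaqs (fun ν => z ν - ((2 * ℓ + 1 + ℓT : ℕ) : ℤ)) (fun ν => z ν + ((2 * ℓ + 1 + ℓT : ℕ) : ℤ) + 2) : Set (Plaq P 0)) ⊆ S) :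
    dist1 (gaugeAct (fun x => holAt U (path x)) U ⟨s, μ⟩) ≤ ((((2 * ℓ + 1 + ℓT : ℕ) : ℝ)) ^ 2 / 4) * δ + e + dist1 g := by
  have hlen : w₁.length + 1 + (Ω.length + w₂.length) < P.sitesPerDir 0 := by omega
  have hle : w₁.length + 1 + (Ω.length + w₂.length) ≤ 2 * ℓ + 1 + ℓT := by omega
  have hwlen : ((w₁ ++ (μ, true) :: wordRev (Ω ++ w₂)).length : ℤ) ≤ ((2 * ℓ + 1 + ℓT : ℕ) : ℤ) := by
    rw [length_masterWord]
    exact_mod_cast hle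
  have hS' : (boxPlaqs (fun ν => z ν - ((w₁ ++ (μ, true) :: wordRev (Ω ++ w₂)).length : ℤ))
      (fun ν => z ν + ((w₁ ++ (μ, true) :: wordRev (Ω ++ w₂)).length : ℤ) + 2) : Set (Plaq P 0)) ⊆ S :=
    (boxPlaqs_radius_mono z hwlen).trans hS
  have hloc := plaq_countBox_lt_of_plaqSmallOn_boxPlaqs_length U r₁ z hz (w₁ ++ (μ, true) :: wordRev (Ω ++ w₂)) hU hS'
  have h := dist1_gaugeAct_holAtGauge_le_of_transporter U path r₁ r₂ Ω hΩ g hH s μ w₁ w₂ hps hpt hs ht hlen hδ hloc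
  refine h.trans ?_
  have hcast : ((w₁.length + 1 + (Ω.length + w₂.length) : ℕ) : ℝ) ≤ ((2 * ℓ + 1 + ℓT : ℕ) : ℝ) := by exact_mod_cast hle
  have h0 : (0 : ℝ) ≤ ((w₁.length + 1 + (Ω.length + w₂.length) : ℕ) : ℝ) := by positivity
  have hsq := div_le_div_of_nonneg_right (pow_le_pow_left₀ h0 hcast 2) (by norm_num : (0 : ℝ) ≤ 4)
  nlinarith [mul_le_mul_of_nonneg_right hsq hδ]

end OneBond

/-! ## §2  The forest in word currency: every two-root bond inside a site set, from a root-transporter letter -/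

section Forest

variable {G : Type*} [GaugeGroup G]

/-- The word of a path has the length of the path. [folklore] -/
private theorem length_word {j : ℕ} (p : List (LStep P j)) : (p.map fun s => (s.bond.dir, s.fwd)).length = p.length :=
  List.length_map _

/-- ★★ **EVERY TWO-ROOT BOND INSIDE `Ω` IS NEAR `1` IN THE FOREST GAUGE, GIVEN A ROOT-TRANSPORTER LETTER.**  Forest in word currency (`path x = walk (root x) (word x)`,
`walkEnd (root x) (word x) = x`; `|path x| ≤ ℓ` on `Ω`); `2ℓ + 1 + ℓT <` sites per direction; `PlaqSmallOn S δ U` with the box of radius `2ℓ + 1 + ℓT` (+2) around the root of every site of `Ω`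
inside `S` (`0 ≤ δ`); and the ROOT-TRANSPORTER LETTER: for every bond `b` with both ends in `Ω` and `root b₋ ≠ root b₊` a fine word `Ω_b` from `root b₋` to `root b₊` of length `≤ ℓT` and a group
element `g` with `dist1 (𝒰_U(walk (root b₋) Ω_b)·g⁻¹) ≤ eT`, `dist1 g ≤ dG`.  THEN every such bond has `dist1 ((U^σ) b) ≤ ((2ℓ + 1 + ℓT)²∕4)·δ + eT + dG`.
[cite: Balaban1985Variational, (16)–(18) p.280; Balaban1985RegularSpaces, (1.19) p.79; Balaban1985Averaging, (19)–(20) p.21] -/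
theorem dist1_gaugeAct_holAtGauge_le_of_rootNe (U : GaugeField P 0 G) (path : Site P 0 → List (LStep P 0)) (root : Site P 0 → Site P 0)
    (hwalk : ∀ x, path x = walk (root x) ((path x).map fun s => (s.bond.dir, s.fwd)) ∧
      walkEnd (root x) ((path x).map fun s => (s.bond.dir, s.fwd)) = x)
    (Ω : Set (Site P 0)) {ℓ ℓT : ℕ} (hlen : ∀ x ∈ Ω, (path x).length ≤ ℓ) (hN : 2 * ℓ + 1 + ℓT < P.sitesPerDir 0)
    {S : Set (Plaq P 0)} {δ : ℝ} (hδ : 0 ≤ δ) (hU : PlaqSmallOn S δ U)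
    (hS : ∀ x ∈ Ω, ∃ z : Fin P.d → ℤ, (castSite z : Site P 0) = root x ∧
      (boxPlaqs (fun ν => z ν - ((2 * ℓ + 1 + ℓT : ℕ) : ℤ)) (fun ν => z ν + ((2 * ℓ + 1 + ℓT : ℕ) : ℤ) + 2) : Set (Plaq P 0)) ⊆ S)
    {eT dG : ℝ}
    (hT : ∀ b : PBond P 0, b.src ∈ Ω → b.tgt ∈ Ω → root b.src ≠ root b.tgt →
      ∃ (Ωw : List (Letter P.d)) (g : G), walkEnd (root b.src) Ωw = root b.tgt ∧ Ωw.length ≤ ℓT ∧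
        dist1 (holAt U (walk (root b.src) Ωw) * g⁻¹) ≤ eT ∧ dist1 g ≤ dG)
    {b : PBond P 0} (hbs : b.src ∈ Ω) (hbt : b.tgt ∈ Ω) (hroot : root b.src ≠ root b.tgt) :
    dist1 (gaugeAct (fun x => holAt U (path x)) U b) ≤ ((((2 * ℓ + 1 + ℓT : ℕ) : ℝ)) ^ 2 / 4) * δ + eT + dG := by
  obtain ⟨Ωw, g, hΩw, hΩl, hH, hg⟩ := hT b hbs hbt hroot
  obtain ⟨s, μ⟩ := b
  obtain ⟨z, hz, hSz⟩ := hS s hbs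
  have htgt : (PBond.tgt ⟨s, μ⟩ : Site P 0) = s.shift μ := rfl
  simp only [htgt] at hbt hΩw hH
  obtain ⟨hps, hs⟩ := hwalk s
  obtain ⟨hpt, ht⟩ := hwalk (s.shift μ)
  have h := dist1_gaugeAct_holAtGauge_le_of_transporter_of_boxPlaqs U path (root s) (root (s.shift μ)) Ωw hΩw g hH s μ _ _ hps hpt hs ht
    (ℓ := ℓ) (ℓT := ℓT) (by rw [length_word]; exact hlen s hbs) (by rw [length_word]; exact hlen _ hbt) hΩl hN z hz hδ hU hSz
  linarith

end Forest

/-! ## §3  At the endpoint's objects: `hL_corridor` from the root-transporter letter; linear moduli; the chain socket -/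

section Record

/-- ★★★ **THE CORRIDOR HALF OF THE INTERIOR LETTER AT THE RECORD, FROM A ROOT-TRANSPORTER LETTER (`hL_corridor`).**  For the gauged (2.12) minimiser `U₀^σ` of the endpoint at one
instance (`Ω₁(Z) = maxDomT ν.M₁ Z 1`; tower forest of `𝐁_k(Z)` in word currency with the uniform length bound `ℓ` on `Ω₁(Z)`), ONE plaquette letter `hP : PlaqSmallOn S εP U₀` on a fine
plaquette set containing the boxes of radius `2ℓ + 1 + ℓT` (+2) around the roots of the sites of `Ω₁(Z)` (print's (1.7) for the minimiser on the support, [15] (2) ∕ Thm 1 (8)), and the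
ROOT-TRANSPORTER LETTER with budgets `(ℓT, eT, dG)`: every bond with both ends in `Ω₁(Z)` whose ends have DIFFERENT roots satisfies
`‖↑((U₀^σ) b) − 1‖ ≤ ((2ℓ + 1 + ℓT)²∕4)·εP + eT + dG` — the `hL_corridor` premise of `B15Prop1InteriorLetterSameRoot.interiorLetter_of_sameRoot_of_corridor` with that `Θc`.
[cite: Balaban1985Variational, (2) p.278, Thm 1 (8) p.279, (16)–(18) p.280; Balaban1985RegularSpaces, (1.7) p.77, (1.19) p.79; Balaban1985Averaging, (19)–(20) p.21] -/
theorem interiorLetter_corridor_atRecord {F : T4Family} (ν : Node00.Stage7Numerics) (Kt : ℕ) (Z : Set (Site (F.P Kt) 0))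
    (path : Site (F.P Kt) 0 → List (LStep (F.P Kt) 0)) (root : Site (F.P Kt) 0 → Site (F.P Kt) 0)
    (hwalk : ∀ x, path x = walk (root x) ((path x).map fun s => (s.bond.dir, s.fwd)) ∧
      walkEnd (root x) ((path x).map fun s => (s.bond.dir, s.fwd)) = x)
    {ℓ ℓT : ℕ} (hlen : ∀ x ∈ maxDomT ν.M₁ Z 1, (path x).length ≤ ℓ) (hN : 2 * ℓ + 1 + ℓT < (F.P Kt).sitesPerDir 0)
    (U₀ : GaugeField (F.P Kt) 0 SU2) {S : Set (Plaq (F.P Kt) 0)} {εP : ℝ} (hεP : 0 ≤ εP) (hP : PlaqSmallOn S εP U₀)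
    (hS : ∀ x ∈ maxDomT ν.M₁ Z 1, ∃ z : Fin (F.P Kt).d → ℤ, (castSite z : Site (F.P Kt) 0) = root x ∧
      (boxPlaqs (fun κ => z κ - ((2 * ℓ + 1 + ℓT : ℕ) : ℤ)) (fun κ => z κ + ((2 * ℓ + 1 + ℓT : ℕ) : ℤ) + 2) : Set (Plaq (F.P Kt) 0)) ⊆ S)
    {eT dG : ℝ}
    -- DISPLAYED: the root-transporter letter ([15] (16)–(18) between the points of `𝔅_k`)
    (hT : ∀ b : PBond (F.P Kt) 0, b.src ∈ maxDomT ν.M₁ Z 1 → b.tgt ∈ maxDomT ν.M₁ Z 1 → root b.src ≠ root b.tgt →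
      ∃ (Ωw : List (Letter (F.P Kt).d)) (g : SU2), walkEnd (root b.src) Ωw = root b.tgt ∧ Ωw.length ≤ ℓT ∧
        dist1 (holAt U₀ (walk (root b.src) Ωw) * g⁻¹) ≤ eT ∧ dist1 g ≤ dG) :
    ∀ b : PBond (F.P Kt) 0, b.src ∈ maxDomT ν.M₁ Z 1 → b.tgt ∈ maxDomT ν.M₁ Z 1 → root b.src ≠ root b.tgt →
      ‖((gaugeAct (fun x => holAt U₀ (path x)) U₀ b : SU2) : Matrix (Fin 2) (Fin 2) ℂ) - 1‖ ≤
        ((((2 * ℓ + 1 + ℓT : ℕ) : ℝ)) ^ 2 / 4) * εP + eT + dG :=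
  fun _ hbs hbt hroot => dist1_gaugeAct_holAtGauge_le_of_rootNe U₀ path root hwalk (maxDomT ν.M₁ Z 1) hlen hN hεP hP hS hT hbs hbt hroot

/-- ★ **ALL THREE DATA LINEAR IN THE GUARD ⟹ `Θc` LINEAR**: from `εP ≤ CP·eR`, `eT ≤ CT·eR`, `dG ≤ CG·eR` (`0 ≤ CP`) the corridor tolerance `((2ℓ+1+ℓT)²∕4)·εP + eT + dG` is
`≤ (((2ℓ+1+ℓT)²∕4)·CP + CT + CG)·eR` — the `hΘc` input of `B15Prop1InteriorLetterSameRoot.interiorLetter_of_sameRoot_of_corridor_linear`.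
[cite: Balaban1989LargeFieldI, Prop. 1 p.194 («for ε > 0 sufficiently small»); Balaban1985Variational, (16)–(18) p.280] -/
theorem interiorLetter_corridor_linear {R εP eT dG CP CT CG eR : ℝ} (hεP : εP ≤ CP * eR) (heT : eT ≤ CT * eR) (hdG : dG ≤ CG * eR) (hR : 0 ≤ R) :
    R * εP + eT + dG ≤ (R * CP + CT + CG) * eR := by
  nlinarith [mul_le_mul_of_nonneg_left hεP hR]

/-- ★ **THE SECOND LAYER's SOCKET: A ROOT TRANSPORTER FROM A CHAIN OF LINKS.**  Links `(ω_l, g_l, e_l)` read consecutively from a root `x` (fine words `ω_l` — straight member-bond segments,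
forward or backward; group elements `g_l` — the member averages `M(c_l)^{±1}`; budgets `e_l` — dag-n12-w2's `θ`), each with its own transporter letter from its own start point, give
the datum of the root-transporter letter for the pair `(x, walkEnd x (ω_1⋯ω_m))`: the word `Ω = ω_1⋯ω_m` of length `Σ |ω_l|`, `g = Π g_l`, `dist1 (𝒰(walk x Ω)·g⁻¹) ≤ Σ e_l` and
`dist1 g ≤ Σ dist1 g_l` (`T4ForestGaugeCorridorBound` §3, by name). [cite: Balaban1985Averaging, (19)–(20) p.21; Balaban1985Variational, (16)–(18) p.280] -/
theorem rootTransporter_of_chain {j : ℕ} {G : Type*} [GaugeGroup G] (U : GaugeField P j G)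
    (links : List (List (Letter P.d) × G × ℝ)) (x : Site P j)
    (hlinks : ∀ (pre post : List (List (Letter P.d) × G × ℝ)) (link : List (Letter P.d) × G × ℝ), links = pre ++ link :: post →
      dist1 (holAt U (walk (walkEnd x (pre.map Prod.fst).flatten) link.1) * (link.2.1)⁻¹) ≤ link.2.2) :
    ((links.map Prod.fst).flatten).length = (links.map fun l => l.1.length).sum ∧
      dist1 (holAt U (walk x (links.map Prod.fst).flatten) * ((links.map fun l => l.2.1).prod)⁻¹) ≤ (links.map fun l => l.2.2).sum ∧
      dist1 (links.map fun l => l.2.1).prod ≤ ((links.map fun l => l.2.1).map dist1).sum :=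
  ⟨length_flatten_map_fst links, dist1_holAt_chain_mul_prod_inv_le U links x hlinks, dist1_prod_le_sum _⟩

end Record

end Literature.MathematicalPhysics.QuantumFieldTheory.Balaban1983to89.B15Prop1InteriorLetterCorridor

end
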